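import Literature.MathematicalPhysics.QuantumFieldTheory.Balaban1983to89.B8TowerBondsLayerLawOfLam
import Literature.MathematicalPhysics.QuantumFieldTheory.Balaban1983to89.Node00.CarriersB8SubBP2C

/-!
# `Balaban1983to89.B8TowerBondsLayerLawSubC` — [Balaban1985RegularSpaces] (1.3)–(1.5) p. 77: THE LAYER LAW (L2) ∕ THE P-CLASS LAW `LevelSepPP` ON THE ADMISSIBLE
# SUB-INDEX OF RECORD `Node00.IdxB8SubC θ` (the «P₂C» records' index), BY NAME from `B8TowerBondsLayerLawOfLam`, and the A6 that index was declared out of scope for: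
# print's tower `(ℤᵈ, □₁, …, □_k)` (n05-c's top-cube member, here FULLY PINNED) is ADMISSIBLE and READS (1.5) — so the laws are inhabited ON THE INDEX OF RECORD, every depth

statement-level skeleton of published theorems with citation tags; proofs where landed; nothing here is a claim about the Yang–Mills mass gap

T. Bałaban, *Spaces of regular gauge field configurations on a lattice and gauge fixing conditions*, Commun. Math. Phys. **99** (1985) 75–102
`[Balaban1985RegularSpaces]` ("B8"; journal page = PDF page + 74): (1.3)–(1.6) p. 77 («Ω₀ ⊃ Ω₁ ⊃ … ⊃ Ω_k», «Ω_j = Bʲ(Ω_j^{(j)})», «Λ_j = Ω_j^{(j)} ∖ Ω_{j+1}^{(j)}»),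
(1.19) p. 79 ∕ (1.34) p. 82 (truncated towers), (1.31) p. 82, (1.68) p. 88, (1.131) p. 99 («Λ′₀ = T ∖ □₁»), p. 98.  T. Bałaban, *Propagators and renormalization
transformations for lattice gauge theories. II*, Commun. Math. Phys. **96** (1984) 223–250 `[Balaban1984PropagatorsII]` ("B6"), (2.1)–(2.3) p. 224.  T. Bałaban,
*Propagators for lattice gauge theories in a background field*, Commun. Math. Phys. **99** (1985) 389–434 `[Balaban1985BackgroundPropagators]` ([4]), (3.16) p. 393.

## WHY THIS FILE (cell `pub-ymgap`, HUMAN RULING D-0062 ∕ D-0149; DAG node N05 = [B8] (edge N06 → N05); width seat `pub-ymgap-dag-n05-w2` g3; proof lane, count-neutral)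

dag-n05-w6 g2's `B8TowerBondsLayerLawOfLam` (p609116) derives the layer law (L2) of this seat's g2 `B8TowerBondsLevelSep` from print's (1.5) AS TYPED
(`B8ConstraintBonds.Lam`) + the admissibility record's saturation (`DomainSeq.sat`) + law №8, for abstract members `i : ZdIdx d L` carrying `IdxB8Laws L i` and
`DomainSeq L i.Ω` as displayed hypotheses, and exhibits the hypotheses on print's cube family `{□_j}` (`Ω₀ = □₀` — NOT a member of the index of record, whose
`Ω₀ = T`).  Its HONEST SCOPE: «for the family `(T, □₁, …, □_k)` … no member-level corollary is stated» (its members' level-`0` tops are not exported field-wise by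
`exists_topCube_member_lawsB`).  The consumers of the class law, however, are keyed on NODE 00's indices: the «P₂C» records (n05-w1 `Node00/CarriersB8SubBP2C`,
`Node00/Record13CarriersB8SubBP2C…`) live on the ADMISSIBLE SUB-INDEX OF RECORD `IdxB8SubC θ = {j : IdxB8SubB θ ∕∕ DomainSeq θ.L j.Ω}` — where the two laws the
member forms display (`IdxB8Laws`, `DomainSeq`) are FIELDS of the index.  THIS FILE (the declarer's offer, cell bus 2026-08-28 06:13Z ∕ 06:17Z) states the faces
there BY NAME — ONE displayed clause left, «the member's top restriction family reads (1.5) below the top» — and supplies the A6 on the index of record at EVERY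
depth: n05-c's construction of print's tower `(ℤᵈ, □₁, …, □_k)` is re-run with its WHOLE restriction family exported (`Λ′₀ = T ∖ □₁` at level `0`, `cubeLamS` above;
the landed theorem exports only the depth-`1` faces `Λs 1 0`, `Λs 1 1`), the tower is admissible (`cubeFam_domainSeq true`, `ρ = L`), and its top family IS print's
(1.131) = the (1.5) territories of its own record (r05's `smul_mem_Lam_cubeFam_iff`) — so it is a term of `IdxB8SubC θ` reading (1.5), and the class law ∕ (L2) hold
there with NOTHING displayed, at every depth `k ≥ 1` and every truncation `m ≤ k`.

## WHAT IS PROVED (kernel, 0 sorry; theorems only)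

* §1 faces on `j : IdxB8SubC θ` (laws and admissibility supplied by the index, BY NAME): `IdxB8SubC.layerLaw_of_lamTop` ((L2) at every `m ≤ k`: the `hlay` of
  `B8TowerBondsLevelSep`), ★ `IdxB8SubC.levelSepPP_towerBondsP_of_lamTop` (`∀ m ≤ k`, the P-class law at print's class `towerBondsP θ.L j.Ω (j.Λs m)`),
  `IdxB8SubC.levelSepPP_towerBondsP_trunc_of_lamTop` (truncated class map, every `m`), `IdxB8SubC.avgAtP_withQQP_towerBondsP_trunc_of_lamTop` ∕
  `IdxB8SubC.avgAtγ_withQQP_towerBondsP_trunc_of_lamTop` (dag-n06-b's genuine-letter averaging binders at print's class of an admissible record member; `2 ≤ θ.D`).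
* §2 A6 ON THE INDEX OF RECORD, EVERY DEPTH: ★ `exists_topCube_member_pinned` (print's `(T, □₁, …, □_k)` as a `ZdIdx` member with `k, η, Ω, Λs, Λb` ALL PINNED +
  `IdxB8LawsB` — n05-c's `exists_topCube_member_lawsB` re-run with the full restriction family exported; `1 ≤ L ≤ ρ`, `k ≥ 1`, `Lᵏη ≤ 1`), ★ `topCube_pinned_lamTop_iff`
  (its top family READS (1.5) at every level `j < k`, both directions — (1.131) = (1.5), r05's `smul_mem_Lam_cubeFam_iff`), ★ `exists_idxB8SubC_topCube_pinned` (for EVERY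
  `θ` and `k ≥ 1` a term `j : IdxB8SubC θ` with `j.k = k`, `j.η = L⁻ᵏ`, `j.Ω = cubeFam true θ.L 0 1 θ.L k`, `j.Λs` pinned, reading (1.5) below the top),
  ★ `exists_idxB8SubC_levelSepPP_towerBondsP` (hence (L2) at every `m ≤ k` and the class law `LevelSepPP θ.L m j.Ω (fun m' l => towerBondsP θ.L j.Ω (j.Λs m') l) 1`
  hold at a member of the «P₂C» index with nothing displayed — the §1 hypotheses are JOINTLY INHABITED on the index of record, at every depth).

## HONEST SCOPE

By-name faces + one non-vacuity witness; lattice bookkeeping; NO estimate of [Balaban1985RegularSpaces] ∕ [4] is proved or asserted; the (1.5)-reading stays a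
DISPLAYED hypothesis on abstract members of `IdxB8SubC θ` (it is not among the typed laws; n05-a's `Ω_j = ℤᵈ` members read it only where `Λ_j = ∅`); §2's member is
print's own tower, so the clause is print's there; the binders' further inputs and the sockets' satisfiability at `m ≥ 1` ([4] Thm 3.3, N06 content) untouched.  §2's
construction is n05-c's (`exists_topCube_member_lawsB`, p576185) with a stronger export — the proof route is theirs and is cited, not claimed.  Count-neutral; N05 ∕ N06 NOT discharged; no count claim (the chair's single count line is the only
count); `T_η ↦ ℤᵈ`; one finite `𝕋⁴` programme at fixed `ε`, Bałaban AS PRINTED; the Yang–Mills mass gap (Clay) is NOT proved by any of this — R4 closes the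
conditional finite-`𝕋⁴` rung `BalabanLadder.UV` only; nothing continuum ∕ ℝ⁴ ∕ OS.  No `sorry`, no `def`, no `instance`, no `notation`.  Unit `pub-ymgap-dag-n05-w2`
(g3), 2026-08-28.

RELATED IN THE TREE, NOT DUPLICATED AS STATEMENTS: `B8TowerBondsLayerLawOfLam` (n05-w6 g2: the law from (1.5), member forms, `{□_j}` A6 — USED), `B8TowerBondsLevelSep` (this
seat g2: the class-law lemma, (L1) from `DomainSeq` — through the former), `Node00/CarriersB8SubBP2C` (n05-w1: `IdxB8SubC`, USED), `B8SockB9P3ShellModeVacuityUniv` (n05-c: the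
lawful top-cube member with two depth-`1` faces — §2 RE-RUNS its construction for the full export), `B8CubeMemberZd` ∕ `B8CubeMemberIdxB8Laws` ∕ `B8SockHFPCubeMember` (n05-c ∕
n05-a: `cubeLamS`, `htower_cubeLam`, `hpart_cubeLam`, `cover_cubeLamS`, `h8lt∕h8top_cubeLamS`, USED), `B8Eq131CubesAdmissible` (r05: `cubeFam_domainSeq`, `smul_mem_Lam_cubeFam_iff`,
USED), `B8IdxB8LawsB` (`towerBonds`, USED), `B8ConstraintBonds` (`DomainSeq`, `Lam`, USED).

[cite: Balaban1985RegularSpaces, (1.3)–(1.6) p.77, (1.19) p.79, (1.31) p.82, (1.34) p.82, (1.68) p.88, (1.131) p.99, p.98; Balaban1984PropagatorsII, (2.1)–(2.3) p.224;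
Balaban1985BackgroundPropagators, (3.16) p.393]
-/

noncomputable section

namespace Literature.MathematicalPhysics.QuantumFieldTheory.Balaban1983to89.B8TowerBondsLayerLawSubC

open B7Prop1Explicit B7Prop1Local
open B8Ineq132 (Under)
open B8LeafModelZd (ZdIdx)
open B8ConstraintBonds (DomainSeq Lam)
open B8Ineq130 (tlo thi)
open B8Eq131Cubes (cube LamP mem_cube_iff cube_succ_subset)
open B8Eq131CubesAdmissible (cubeFam cubeFam_false_zero cubeFam_true_zero cubeFam_of_pos cubeFam_domainSeq smul_mem_Lam_cubeFam_iff)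
open B8CubeMemberZd (cubeLam cubeLamS cubeLamS_of_lt cubeLamS_self cubeLamS_top cubeLam_eq_LamP mem_cubeLam_zero_iff htower_cubeLam hpart_cubeLam)
open B8CubeMemberIdxB8Laws (cover_cubeLamS)
open B8Eq131Derivation (under_zero_iff)
open B8Eq191FlatLettersCubeMember (under_iff_blockMap_eq)
open Literature.MathematicalPhysics.QuantumLattice (blockSites mem_blockSites_iff)
open B8TowerBondsPrinted (towerBondsP)
open B9Eq316AveragingTransposeZdPrinted (LevelSepPP)
open B8IdxB8LawsB (towerBonds towerBonds_hbox towerBonds_hclass IdxB8LawsB IdxB8SubB)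
open B8TowerBondsLayerLawOfLam (layer_member_of_lamTop levelSepPP_towerBondsP_member_of_lamTop levelSepPP_towerBondsP_trunc_of_lamTop
  avgAtP_withQQP_towerBondsP_trunc_of_lamTop avgAtγ_withQQP_towerBondsP_trunc_of_lamTop)
open Node00 (Stage3Params IdxB8SubC)

-- `Site` alone could resolve to the torus sites of `Setup.lean`; re-export the `ℤ^d` sites of `B7Prop1Explicit`.
export B7Prop1Explicit (Site)

/-- `1 ≤ θ.L` (Bałaban's block size is odd `> 1`; private plumbing). [folklore] -/
private theorem one_le_L (θ : Stage3Params) : 1 ≤ θ.L := le_trans (by norm_num) θ.two_le_L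

/-! ## §1 The faces on the admissible sub-index of record `IdxB8SubC θ` -/

section Faces

variable {θ : Stage3Params}

/-- **(L2) ON THE ADMISSIBLE SUB-INDEX OF RECORD**: at a member `j : IdxB8SubC θ` (laws №7∕№8∕№11∕№12 and the (1.3)–(1.4) record `DomainSeq` are FIELDS of the index)
whose top restriction family reads (1.5) below the top, the layer law — the `hlay` of `B8TowerBondsLevelSep.levelSepPP_towerBondsP_member ∕ _trunc` — holds at every
truncation `m ≤ k` (`B8TowerBondsLayerLawOfLam.layer_member_of_lamTop` by name). [cite: Balaban1985RegularSpaces, (1.5) p.77, (1.4) p.77, (1.19) p.79, (1.34) p.82] -/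
theorem IdxB8SubC.layerLaw_of_lamTop (j : IdxB8SubC θ)
    (hΛ : ∀ l, l < j.1.1.1.k → ∀ z ∈ j.1.1.1.Λs j.1.1.1.k l, ((θ.L : ℤ) ^ l) • z ∈ Lam θ.L j.1.1.1.Ω l) :
    ∀ m, m ≤ j.1.1.1.k → ∀ l, l < m → ∀ z ∈ j.1.1.1.Λs m l, ∀ x, Under θ.L l z x → x ∉ j.1.1.1.Ω (l + 1) :=
  B8TowerBondsLayerLawOfLam.layer_member_of_lamTop (one_le_L θ) j.1.1.1 j.1.2.toIdxB8Laws j.2 hΛ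

/-- ★ **THE P-CLASS LAW ON THE ADMISSIBLE SUB-INDEX OF RECORD**: at such a member, for every truncation `m ≤ k`,
`LevelSepPP θ.L m j.Ω (fun m' l => towerBondsP θ.L j.Ω (j.Λs m') l) 1` — print's class (1.31) of the member's Λ-tower, box `⊂ Ω_{l−1}`, unit collar — with NO
index law displayed beyond the (1.5)-reading (`levelSepPP_towerBondsP_member_of_lamTop` by name).
[cite: Balaban1985RegularSpaces, (1.31) p.82, (1.3)–(1.5) p.77; Balaban1984PropagatorsII, (2.1)–(2.3) p.224] -/
theorem IdxB8SubC.levelSepPP_towerBondsP_of_lamTop (j : IdxB8SubC θ)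
    (hΛ : ∀ l, l < j.1.1.1.k → ∀ z ∈ j.1.1.1.Λs j.1.1.1.k l, ((θ.L : ℤ) ^ l) • z ∈ Lam θ.L j.1.1.1.Ω l) :
    ∀ m, m ≤ j.1.1.1.k → LevelSepPP θ.L m j.1.1.1.Ω (fun m' l => towerBondsP θ.L j.1.1.1.Ω (j.1.1.1.Λs m') l) 1 :=
  B8TowerBondsLayerLawOfLam.levelSepPP_towerBondsP_member_of_lamTop (one_le_L θ) j.1.1.1 j.1.2.toIdxB8Laws j.2 hΛ

/-- **The same through the TRUNCATED class map, every `m`** (dag-n06-b's junk-level recipe; vacuous above `k`): `levelSepPP_towerBondsP_trunc_of_lamTop` by name.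
[cite: Balaban1985RegularSpaces, (1.31) p.82, (1.68) p.88, (1.3)–(1.5) p.77; Balaban1984PropagatorsII, (2.3) p.224] -/
theorem IdxB8SubC.levelSepPP_towerBondsP_trunc_of_lamTop (j : IdxB8SubC θ)
    (hΛ : ∀ l, l < j.1.1.1.k → ∀ z ∈ j.1.1.1.Λs j.1.1.1.k l, ((θ.L : ℤ) ^ l) • z ∈ Lam θ.L j.1.1.1.Ω l) (m : ℕ) :
    LevelSepPP θ.L m j.1.1.1.Ω (fun m' l => if m' ≤ j.1.1.1.k then towerBondsP θ.L j.1.1.1.Ω (j.1.1.1.Λs m') l else ∅) 1 :=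
  B8TowerBondsLayerLawOfLam.levelSepPP_towerBondsP_trunc_of_lamTop (one_le_L θ) j.1.1.1 j.1.2.toIdxB8Laws j.2 hΛ m

variable {𝔸 : Type*} [CStarAlgebra 𝔸] (τ : 𝔸 →ₗ[ℂ] ℂ) [FiniteDimensional ℝ 𝔸] [Nontrivial 𝔸]

open B9SupplySockB9P3ZdLetters (OpsZd)
open B9SupplySockB9P3ZdGammaUniv (AvgAtP)
open B9SupplySockB9P3ZdGamma (AvgAtγ)
open B9Eq316AveragingTransposeZd (qQ betaTau)
open B9Eq316AveragingTransposeZdPrinted (withQQP)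

/-- ★ **dag-n06-b's GENUINE-LETTER `AvgAtP` BINDER AT PRINT'S CLASS OF AN ADMISSIBLE RECORD MEMBER** (`j : IdxB8SubC θ`, `2 ≤ θ.D`; every truncation `m` through the
truncated class map): the only displayed geometric clause is the (1.5)-reading of the member's top family (`avgAtP_withQQP_towerBondsP_trunc_of_lamTop` by name; constant
`qQ θ.D θ.L C_τ β_τ 1`). [cite: Balaban1985BackgroundPropagators, (3.16) p.393; Balaban1985RegularSpaces, (1.56), (1.58) p.86, (1.31) p.82, (1.3)–(1.5) p.77, (1.68) p.88] -/
theorem IdxB8SubC.avgAtP_withQQP_towerBondsP_trunc_of_lamTop (hD : 2 ≤ θ.D)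
    {Cτ : ℝ} (hCτ : ∀ x y : 𝔸, |(τ (star x * y)).re| ≤ Cτ * ‖x‖ * ‖y‖)
    (ops₀ : ℝ → ZdIdx θ.D θ.L → ℕ → OpsZd θ.D 𝔸) (M : ℝ) (j : IdxB8SubC θ)
    (hΛ : ∀ l, l < j.1.1.1.k → ∀ z ∈ j.1.1.1.Λs j.1.1.1.k l, ((θ.L : ℤ) ^ l) • z ∈ Lam θ.L j.1.1.1.Ω l) (m : ℕ) :
    AvgAtP θ.L (withQQP τ θ.L (fun m' l => if m' ≤ j.1.1.1.k then towerBondsP θ.L j.1.1.1.Ω (j.1.1.1.Λs m') l else ∅) ops₀) (qQ θ.D θ.L Cτ (betaTau τ) 1)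
      (fun m' l => if m' ≤ j.1.1.1.k then towerBondsP θ.L j.1.1.1.Ω (j.1.1.1.Λs m') l else ∅) M j.1.1.1 m :=
  B8TowerBondsLayerLawOfLam.avgAtP_withQQP_towerBondsP_trunc_of_lamTop τ hD θ.two_le_L hCτ ops₀ M j.1.1.1 j.1.2.toIdxB8Laws j.2 hΛ m

/-- ★ **The same in the γ currency** (`AvgAtγ`, the binder of the γ suppliers `sockB9P3D4γ(I)_at`): `avgAtγ_withQQP_towerBondsP_trunc_of_lamTop` by name.
[cite: Balaban1985BackgroundPropagators, (3.16) p.393; Balaban1985RegularSpaces, (1.56), (1.58) p.86, (1.31) p.82, (1.3)–(1.5) p.77, (1.68) p.88] -/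
theorem IdxB8SubC.avgAtγ_withQQP_towerBondsP_trunc_of_lamTop (hD : 2 ≤ θ.D)
    {Cτ : ℝ} (hCτ : ∀ x y : 𝔸, |(τ (star x * y)).re| ≤ Cτ * ‖x‖ * ‖y‖)
    (ops₀ : ℝ → ZdIdx θ.D θ.L → ℕ → OpsZd θ.D 𝔸) (M : ℝ) (j : IdxB8SubC θ)
    (hΛ : ∀ l, l < j.1.1.1.k → ∀ z ∈ j.1.1.1.Λs j.1.1.1.k l, ((θ.L : ℤ) ^ l) • z ∈ Lam θ.L j.1.1.1.Ω l) (m : ℕ) :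
    AvgAtγ θ.L (withQQP τ θ.L (fun m' l => if m' ≤ j.1.1.1.k then towerBondsP θ.L j.1.1.1.Ω (j.1.1.1.Λs m') l else ∅) ops₀) (qQ θ.D θ.L Cτ (betaTau τ) 1)
      (fun m' l => if m' ≤ j.1.1.1.k then towerBondsP θ.L j.1.1.1.Ω (j.1.1.1.Λs m') l else ∅) M j.1.1.1 m :=
  B8TowerBondsLayerLawOfLam.avgAtγ_withQQP_towerBondsP_trunc_of_lamTop τ hD θ.two_le_L hCτ ops₀ M j.1.1.1 j.1.2.toIdxB8Laws j.2 hΛ m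

end Faces

/-! ## §2 A6 on the index of record, EVERY depth: print's tower `(ℤᵈ, □₁, …, □_k)` FULLY PINNED, admissible, reading (1.5) -/

section Witness

variable {d L : ℕ}

/-- ★ **PRINT'S TOWER `(T, □₁, …, □_k)` AS A FULLY PINNED LAWFUL MEMBER** — n05-c's `B8SockB9P3ShellModeVacuityUniv.exists_topCube_member_lawsB` (same construction,
same proof route, cited) with the WHOLE restriction family exported instead of its two depth-`1` faces: `Ω = cubeFam true L a M ρ k` (`Ω₀ = ℤᵈ`, `Ω_j = □_j`),
`Λs m j =` print's `Λ′₀ = T ∖ □₁` at level `0` of every truncation `m ≥ 1` (`ℤᵈ` at `m = 0`) and n05-c's `cubeLamS L a M ρ k m j` at levels `j ≥ 1` ((1.131) ∕ (1.68)),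
`Λb = towerBonds` (№12), the located laws №7 ∕ №8 ∕ №11 (`IdxB8LawsB`); `1 ≤ L ≤ ρ`, `k ≥ 1`, `0 < η`, `Lᵏη ≤ 1`.  The export is what a level-wise A6 on the index of
record needs (the (1.5)-reading below the top, next theorem). [cite: Balaban1985RegularSpaces, (1.131) p.99 («Λ′₀ = T ∖ □₁, Λ′_j = □_j^{(j)} ∖ □_{j+1}^{(j)}»), (1.3)–(1.6) p.77, (1.68) p.88, p.98] -/
theorem exists_topCube_member_pinned (hL : 1 ≤ L) (a : Site d) (M : ℕ) {ρ : ℕ} (hρ : L ≤ ρ) {k : ℕ} (hk : 1 ≤ k)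
    {η : ℝ} (hη : 0 < η) (hscale : (L : ℝ) ^ k * η ≤ 1) :
    ∃ i : ZdIdx d L, i.k = k ∧ i.η = η ∧ i.Ω = cubeFam true L a M ρ k ∧
      (i.Λs = fun m j => if j = 0 then (if m = 0 then Set.univ else (cube L a M ρ k 1)ᶜ) else cubeLamS L a M ρ k m j) ∧
      (∀ m j, i.Λb m j = towerBonds L i.Ω (i.Λs m) j) ∧ IdxB8LawsB L i := by
  classical
  haveI : NeZero L := ⟨by omega⟩
  -- the truncated tower with print's `Λ′₀` (n05-c's `ΛT`)
  let ΛT : ℕ → ℕ → Set (Site d) := fun m j =>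
    if j = 0 then (if m = 0 then Set.univ else (cube L a M ρ k 1)ᶜ) else cubeLamS L a M ρ k m j
  have hT0 : ∀ m, 1 ≤ m → ΛT m 0 = (cube L a M ρ k 1)ᶜ := fun m hm => by
    simp only [ΛT, if_pos rfl, if_neg (show m ≠ 0 by omega)]
  have hT00 : ΛT 0 0 = Set.univ := by simp [ΛT]
  have hTpos : ∀ m j, 1 ≤ j → ΛT m j = cubeLamS L a M ρ k m j := fun m j hj => by
    simp only [ΛT, if_neg (show j ≠ 0 by omega)]
  have h10 : cube L a M ρ k 1 ⊆ cube L a M ρ k 0 := cube_succ_subset (by omega)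
  have hΩpos : ∀ j, 1 ≤ j → j ≤ k → cubeFam true L a M ρ k j = cubeFam false L a M ρ k j := fun j hj hjk => by
    rw [cubeFam_of_pos true L a M ρ hj hjk, cubeFam_of_pos false L a M ρ hj hjk]
  have hlam0 : ∀ y ∈ cubeLamS L a M ρ k k 0, y ∈ (cube L a M ρ k 1)ᶜ := fun y hy => by
    rw [cubeLamS_of_lt L a M ρ k (by omega : 0 < k)] at hy
    exact ((mem_cubeLam_zero_iff hL a M ρ hk y).1 hy).2
  have hself0 : ∀ x : Site d, InBox (tlo L x 0) (thi L x 0) x := fun x i => by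
    simp [B8Ineq130.tlo_zero, B8Ineq130.thi_zero]
  refine ⟨⟨η, hη, k, hk, cubeFam true L a M ρ k, fun j => (cubeFam_domainSeq true hL a M hρ k).anti j, ΛT,
    fun m j => towerBonds L (cubeFam true L a M ρ k) (ΛT m) j,
    towerBonds_hbox L _ ΛT k, towerBonds_hclass L _ ΛT k, ?_, ?_⟩, rfl, rfl, rfl, rfl, fun _ _ => rfl, ?_⟩
  · -- htower
    intro j hj y hy x hx
    rcases Nat.eq_zero_or_pos j with rfl | hjpos
    · rw [cubeFam_true_zero]; exact Set.mem_univ x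
    · rw [hTpos k j hjpos] at hy
      rw [hΩpos j hjpos hj]
      exact htower_cubeLam hL a M ρ k j hj y hy x hx
  · -- hpart
    intro x _
    by_cases hx0 : x ∈ cube L a M ρ k 0
    · obtain ⟨j, hjk, y, hy, hB⟩ := hpart_cubeLam hL a M ρ k x (by rw [cubeFam_false_zero]; exact hx0)
      rcases Nat.eq_zero_or_pos j with rfl | hjpos
      · exact ⟨0, hjk, y, by rw [hT0 k hk]; exact hlam0 y hy, hB⟩
      · exact ⟨j, hjk, y, by rw [hTpos k j hjpos]; exact hy, hB⟩
    · exact ⟨0, Nat.zero_le k, x, by rw [hT0 k hk]; exact fun h => hx0 (h10 h), hself0 x⟩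
  · -- the located laws (n05-c's proof, verbatim route)
    refine ⟨⟨hscale, ?_, ?_, ?_⟩, fun _ _ => rfl⟩
    · -- №8 below the top
      intro m hm j hj
      show ΛT m j = ΛT (m + 1) j
      rcases Nat.eq_zero_or_pos j with rfl | hjpos
      · rw [hT0 m (by omega), hT0 (m + 1) (by omega)]
      · rw [hTpos m j hjpos, hTpos (m + 1) j hjpos]
        exact B8SockHFPCubeMember.h8lt_cubeLamS L a M ρ k m hm j hj
    · -- №8 at the top
      intro m hm x
      show x ∈ ΛT m m ↔ x ∈ ΛT (m + 1) m ∨ ∃ y ∈ ΛT (m + 1) (m + 1), x ∈ blockSites L y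
      rcases Nat.eq_zero_or_pos m with rfl | hmpos
      · rw [hT00, hT0 1 le_rfl, hTpos 1 1 le_rfl, cubeLamS_self]
        refine ⟨fun _ => ?_, fun _ => Set.mem_univ x⟩
        by_cases hx1 : x ∈ cube L a M ρ k 1
        · obtain ⟨z, hz, hu⟩ := (mem_cube_iff hL).1 hx1
          refine Or.inr ⟨z, hz, ?_⟩
          rw [mem_blockSites_iff]
          have := (under_iff_blockMap_eq hL 1 z x).1 hu
          rwa [pow_one] at this
        · exact Or.inl hx1
      · rw [hTpos m m hmpos, hTpos (m + 1) m hmpos, hTpos (m + 1) (m + 1) (by omega)]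
        exact B8SockHFPCubeMember.h8top_cubeLamS hL a M ρ k m hm x
    · -- №11 (1.6) at every level
      intro ℓ hℓ w hw
      show ∃ j, ℓ ≤ j ∧ j ≤ k ∧ ∃ y ∈ ΛT k j, Under L (j - ℓ) y w
      rcases Nat.eq_zero_or_pos ℓ with rfl | hℓpos
      · by_cases hw0 : w ∈ cube L a M ρ k 0
        · have hw' : ∀ x, InBox (tlo L w 0) (thi L w 0) x → x ∈ cubeFam false L a M ρ k 0 := by
            intro x hx
            have hxw : x = w := funext fun i => by
              have := hx i; simp [B8Ineq130.tlo_zero, B8Ineq130.thi_zero] at this; omega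
            rw [hxw, cubeFam_false_zero]; exact hw0
          obtain ⟨j, h0j, hjk, y, hy, hU⟩ := cover_cubeLamS hL a M ρ k 0 (Nat.zero_le k) w hw'
          rcases Nat.eq_zero_or_pos j with rfl | hjpos
          · exact ⟨0, le_rfl, hjk, y, by rw [hT0 k hk]; exact hlam0 y hy, hU⟩
          · exact ⟨j, h0j, hjk, y, by rw [hTpos k j hjpos]; exact hy, hU⟩
        · refine ⟨0, le_rfl, Nat.zero_le k, w, by rw [hT0 k hk]; exact fun h => hw0 (h10 h), ?_⟩
          rw [Nat.sub_zero]; exact (under_zero_iff L w w).2 rfl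
      · have hw' : ∀ x, InBox (tlo L w ℓ) (thi L w ℓ) x → x ∈ cubeFam false L a M ρ k ℓ := by
          intro x hx; rw [← hΩpos ℓ hℓpos hℓ]; exact hw x hx
        obtain ⟨j, hℓj, hjk, y, hy, hU⟩ := cover_cubeLamS hL a M ρ k ℓ hℓ w hw'
        exact ⟨j, hℓj, hjk, y, by rw [hTpos k j (by omega)]; exact hy, hU⟩

/-- ★ **THE PINNED TOWER'S TOP FAMILY READS (1.5) AT EVERY LEVEL BELOW THE TOP** (`k ≥ 1`, `j < k`): level `0` — `Λ′₀ = (□₁)ᶜ` is `Λ_0 = Ω₀^{(0)} ∖ Ω₁^{(0)} = ℤᵈ ∖ □₁`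
of the record `(ℤᵈ, □₁, …, □_k)`; levels `1 ≤ j < k` — `cubeLamS … k j = cubeLam … j = Λ′_j = □_j^{(j)} ∖ □_{j+1}^{(j)}` (`cubeLamS_top`, `cubeLam_eq_LamP`); both through
r05's `B8Eq131CubesAdmissible.smul_mem_Lam_cubeFam_iff` («(1.131) = (1.5) for `(T, □₁, …, □_k)`»), BOTH directions. [cite: Balaban1985RegularSpaces, (1.131) p.99, (1.5) p.77] -/
theorem topCube_pinned_lamTop_iff (hL : 1 ≤ L) (a : Site d) (M ρ : ℕ) {k j : ℕ} (hk : 1 ≤ k) (hj : j < k) (z : Site d) :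
    z ∈ (fun m j => if j = 0 then (if m = 0 then (Set.univ : Set (Site d)) else (cube L a M ρ k 1)ᶜ) else cubeLamS L a M ρ k m j) k j ↔
      ((L : ℤ) ^ j) • z ∈ Lam L (cubeFam true L a M ρ k) j := by
  rw [smul_mem_Lam_cubeFam_iff hL a M ρ hk hj.le z]
  rcases Nat.eq_zero_or_pos j with rfl | hjpos
  · have hk0 : k ≠ 0 := by omega
    simp [LamP, hk0]
  · simp only [if_neg (show j ≠ 0 by omega)]
    rw [cubeLamS_top L a M ρ hj.le, cubeLam_eq_LamP L a M ρ k hjpos]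

/-- ★ **THE ADMISSIBLE SUB-INDEX OF RECORD CARRIES PRINT'S TOWER AT EVERY DEPTH, FULLY PINNED, READING (1.5)**: for every `θ` and `k ≥ 1` there is a term
`j : IdxB8SubC θ` (the pinned `(ℤᵈ, □₁, …, □_k)` at `a = 0`, `M = 1`, `ρ = θ.L`, `η = L⁻ᵏ`; admissible by `cubeFam_domainSeq true`) with `j.k = k`,
`j.Ω = cubeFam true θ.L 0 1 θ.L k`, its restriction family PINNED as in `exists_topCube_member_pinned`, and whose top family READS (1.5) below the top (both
directions) — the one displayed clause of §1 is print's, ON the «P₂C» index, at every depth. [cite: Balaban1985RegularSpaces, (1.131) p.99, (1.3)–(1.6) p.77, p.98] -/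
theorem exists_idxB8SubC_topCube_pinned (θ : Stage3Params) {k : ℕ} (hk : 1 ≤ k) :
    ∃ j : IdxB8SubC θ, j.1.1.1.k = k ∧ j.1.1.1.η = ((θ.L : ℝ)⁻¹) ^ k ∧ j.1.1.1.Ω = cubeFam true θ.L 0 1 θ.L k ∧
      (j.1.1.1.Λs = fun m l => if l = 0 then (if m = 0 then Set.univ else (cube θ.L 0 1 θ.L k 1)ᶜ) else cubeLamS θ.L 0 1 θ.L k m l) ∧
      ∀ l, l < j.1.1.1.k → ∀ z, z ∈ j.1.1.1.Λs j.1.1.1.k l ↔ ((θ.L : ℤ) ^ l) • z ∈ Lam θ.L j.1.1.1.Ω l := by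
  have hL : 1 ≤ θ.L := one_le_L θ
  have hL0 : (0 : ℝ) < θ.L := by exact_mod_cast (show 0 < θ.L by omega)
  have hη : (0 : ℝ) < ((θ.L : ℝ)⁻¹) ^ k := pow_pos (inv_pos.mpr hL0) k
  have hscale : (θ.L : ℝ) ^ k * ((θ.L : ℝ)⁻¹) ^ k ≤ 1 := by
    rw [← mul_pow, mul_inv_cancel₀ hL0.ne', one_pow]
  obtain ⟨i, hik, hiη, hΩ, hΛ, -, hlaws⟩ := exists_topCube_member_pinned (d := θ.D) hL (0 : Site θ.D) 1 (le_refl θ.L) hk hη hscale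
  have hΩ0 : i.Ω 0 = Set.univ := by rw [hΩ]; exact cubeFam_true_zero θ.L 0 1 θ.L k
  have hds : DomainSeq θ.L i.Ω := by rw [hΩ]; exact cubeFam_domainSeq true hL 0 1 (le_refl θ.L) k
  refine ⟨(⟨⟨⟨i, hΩ0⟩, hlaws⟩, hds⟩ : {j : IdxB8SubB θ // DomainSeq θ.L j.1.1.Ω}), hik, hiη, hΩ, hΛ, ?_⟩
  show ∀ l, l < i.k → ∀ z, z ∈ i.Λs i.k l ↔ ((θ.L : ℤ) ^ l) • z ∈ Lam θ.L i.Ω l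
  intro l hl z
  rw [hik] at hl
  rw [hΛ, hΩ, hik]
  exact topCube_pinned_lamTop_iff hL 0 1 θ.L hk hl z

/-- ★ **HENCE THE LAYER LAW (L2) AND THE P-CLASS LAW HOLD AT A MEMBER OF THE «P₂C» INDEX AT EVERY DEPTH, WITH NOTHING DISPLAYED** (every `θ`, every `k ≥ 1`,
every truncation `m ≤ k`): the §1 hypotheses — index laws, admissibility, (1.5)-reading — are JOINTLY INHABITED on the admissible sub-index of record by print's tower
`(ℤᵈ, □₁, …, □_k)`; the conclusions at that member come from §1, not from hypotheses.
[cite: Balaban1985RegularSpaces, (1.131) p.99, (1.3)–(1.5) p.77, (1.31) p.82; Balaban1984PropagatorsII, (2.1)–(2.3) p.224] -/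
theorem exists_idxB8SubC_levelSepPP_towerBondsP (θ : Stage3Params) {k : ℕ} (hk : 1 ≤ k) :
    ∃ j : IdxB8SubC θ, j.1.1.1.k = k ∧ j.1.1.1.Ω = cubeFam true θ.L 0 1 θ.L k ∧
      (∀ l, l < j.1.1.1.k → ∀ z ∈ j.1.1.1.Λs j.1.1.1.k l, ((θ.L : ℤ) ^ l) • z ∈ Lam θ.L j.1.1.1.Ω l) ∧
      (∀ m, m ≤ j.1.1.1.k → ∀ l, l < m → ∀ z ∈ j.1.1.1.Λs m l, ∀ x, Under θ.L l z x → x ∉ j.1.1.1.Ω (l + 1)) ∧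
      ∀ m, m ≤ j.1.1.1.k → LevelSepPP θ.L m j.1.1.1.Ω (fun m' l => towerBondsP θ.L j.1.1.1.Ω (j.1.1.1.Λs m') l) 1 := by
  obtain ⟨j, hjk, -, hΩ, -, hreads⟩ := exists_idxB8SubC_topCube_pinned θ hk
  have hΛ : ∀ l, l < j.1.1.1.k → ∀ z ∈ j.1.1.1.Λs j.1.1.1.k l, ((θ.L : ℤ) ^ l) • z ∈ Lam θ.L j.1.1.1.Ω l :=
    fun l hl z hz => (hreads l hl z).mp hz
  exact ⟨j, hjk, hΩ, hΛ, IdxB8SubC.layerLaw_of_lamTop j hΛ, IdxB8SubC.levelSepPP_towerBondsP_of_lamTop j hΛ⟩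

end Witness

end Literature.MathematicalPhysics.QuantumFieldTheory.Balaban1983to89.B8TowerBondsLayerLawSubC

end
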